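import Mathlib
import Summits.Ventures.HodgeRepro.Tier4.Common.SaturationMeasure

/-!
# Tier4/Common/IndexMeasure — the measure of a saturated box in units of the box: `μ (Z · B) = [Z : Z ∩ B] · μ B`,
the relative-index form `μ H = [H : K] · μ K`, and the covering bound `S ⊆ ⋃_{g ∈ F} g B ⇒ μ S ≤ #F · μ B`

Blind re-derivation cell `pub-hodge-repro`, Tier 4 (README §9–§10), seat t4-typer-1 (gen 3).  Target tree path
`lean/Summits/Ventures/HodgeRepro/Tier4/Common/IndexMeasure.lean`.  Imports Mathlib and `Common.SaturationMeasure` (p710190: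
the transversal lemmas `iUnion_smul_eq_mul`, `inv_mul_mem_subgroupOf_of_smul_inter_nonempty`).

WHY — the CURRENCY of the folded ratio (F) (L1-p4 g5 S15641 (F-c)/(F-d), L2-p3 S15509 P3/P4): P4's bound
(`CosetCoveringBound` p709866) is `μ (C ∩ a · (Z · B)) ≤ κ(C) · μ ((Z ⊓ B₀) · B)` and the glue's unit (`SaturationMeasure`) is
`μ (D ∩ Z · B) ≥ μ ((Z ⊓ B₀) · B) / #Γ₀`; both are in the unit `μ (Z⁰ · B)`, `Z⁰ := Z ⊓ B₀` compact.  This module converts that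
unit into the box measure `μ B` times an INDEX, which is what P3 (the level-box index along `p^n`, L4-p2) controls:
* `measure_mul_eq_relIndex_mul_measure`: for subgroups `Z`, `B` with `B.subgroupOf Z` of finite index and `B` measurable,
  `μ ((Z : Set A) * B) = B.relIndex Z * μ B` (`B.relIndex Z = [Z : Z ∩ B]`) — a left transversal `S ⊂ Z` of `Z ∩ B` in `Z`
  decomposes `Z · B = ⊔_{r ∈ S} r B` into `#S = [Z : Z ∩ B]` disjoint translates of `B`; NO normality or commutation is used
  (`Z · B` need not be a subgroup);
* `measure_eq_relIndex_mul_measure_of_le`: `K ≤ H` subgroups, `K` measurable, `K.subgroupOf H` of finite index ⇒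
  `μ H = K.relIndex H * μ K`, and `measure_le_of_relIndex_le`: with `K.relIndex H ≤ M`, `μ H ≤ M * μ K` (P3 in measure form:
  `μ (Z⁰ · B_{n−c₀}) ≤ M(c₀) · μ (Z⁰ · B_n)` from the index bound);
* `finiteIndex_subgroupOf_of_isCompact_of_isOpen`: a compact subgroup meets an open subgroup in finite index (the hypothesis
  of the first two at `Z⁰` compact, `B` open — Mathlib's `quotient_finite_of_isOpen`); `finite_subgroupOf_of_discrete_of_isCompact`:
  a discrete subgroup meets a compact subgroup in a finite set (the `[Finite (H.subgroupOf Γ)]` of `SaturationMeasure` at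
  `Γ := Z(k)` discrete, `H := Z⁰ · B_N` compact-open);
* `measure_le_card_mul_of_subset_biUnion_smul`: `S ⊆ ⋃ g ∈ F, g • U ⇒ μ S ≤ #F · μ U` (outer-measure covering bound, no
  measurability — the shape in which a cover by `≤ M` translates is consumed).

Nothing here says anything about the status of the Hodge conjecture for CM abelian varieties, which is NOT proved
(HC_CM is NOT proved by anyone in this repository).
-/

set_option autoImplicit false

noncomputable section

open MeasureTheory Measure Set Function
open scoped NNReal ENNReal Pointwise

namespace Summit.Ventures.HodgeRepro.Tier4.Common

section Covering

variable {A : Type*} [Group A] [MeasurableSpace A] (μ : Measure A) [μ.IsMulLeftInvariant]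

/-- **The covering bound**: `S ⊆ ⋃ g ∈ F, g • U` (`F` finite) ⇒ `μ S ≤ F.card * μ U`; no measurability. -/
theorem measure_le_card_mul_of_subset_biUnion_smul {S U : Set A} {F : Finset A} (hF : S ⊆ ⋃ g ∈ F, g • U) :
    μ S ≤ F.card * μ U := by
  calc μ S ≤ μ (⋃ g ∈ F, g • U) := measure_mono hF
    _ ≤ ∑ g ∈ F, μ (g • U) := measure_biUnion_finset_le F _
    _ = F.card * μ U := by simp only [measure_smul, Finset.sum_const, nsmul_eq_mul]

end Covering

section Index

variable {A : Type*} [Group A] [MeasurableSpace A] [MeasurableMul A] (μ : Measure A) [μ.IsMulLeftInvariant]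

/-- **The measure of a saturated box in units of the box**: for subgroups `Z`, `B` with `Z ∩ B` of finite index in `Z` and
`B` measurable, `μ ((Z : Set A) * B) = B.relIndex Z * μ B`.  (A left transversal `S ⊂ Z` of `Z ∩ B` in `Z` gives
`Z · B = ⊔_{r ∈ S} r B`, `#S = B.relIndex Z`.)  No normality of `Z` or `B` is used. -/
theorem measure_mul_eq_relIndex_mul_measure (Z B : Subgroup A) (hB : MeasurableSet (B : Set A))
    [(B.subgroupOf Z).FiniteIndex] :
    μ ((Z : Set A) * (B : Set A)) = B.relIndex Z * μ (B : Set A) := by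
  obtain ⟨S, hS, -⟩ := (B.subgroupOf Z).exists_isComplement_left 1
  haveI : Finite S := hS.finite_left
  have hdisj : Pairwise (AEDisjoint μ on fun r : S => (((r : Z) : A)) • (B : Set A)) := by
    intro r r' hrr'
    refine Disjoint.aedisjoint ?_
    rw [Set.disjoint_iff]
    rintro x ⟨hx, hx'⟩
    have hmem : (r : Z)⁻¹ * (r' : Z) ∈ B.subgroupOf Z :=
      inv_mul_mem_subgroupOf_of_smul_inter_nonempty Z B ⟨x, hx, hx'⟩
    have hdis : Disjoint ((r : Z) • (B.subgroupOf Z : Set Z)) ((r' : Z) • (B.subgroupOf Z : Set Z)) :=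
      hS.pairwiseDisjoint_smul r.2 r'.2 (Subtype.val_injective.ne hrr')
    refine (Set.disjoint_iff.1 hdis ⟨?_, ?_⟩ : (r' : Z) ∈ (∅ : Set Z)).elim
    · rw [mem_smul_set_iff_inv_smul_mem, smul_eq_mul]
      exact hmem
    · rw [mem_smul_set_iff_inv_smul_mem, smul_eq_mul, inv_mul_cancel]
      exact (B.subgroupOf Z).one_mem
  have hmeas : ∀ r : S, NullMeasurableSet ((((r : Z) : A)) • (B : Set A)) μ := fun r =>
    (hB.const_smul _).nullMeasurableSet
  rw [← iUnion_smul_eq_mul Z B hS, measure_iUnion₀ hdisj hmeas]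
  simp only [measure_smul, ENNReal.tsum_const, ENat.card_eq_coe_natCard, ENat.toENNReal_coe, hS.card_left]
  rfl

/-- **The relative-index form**: `K ≤ H` subgroups, `K` measurable, `K ∩ H = K` of finite index in `H` ⇒
`μ H = K.relIndex H * μ K`. -/
theorem measure_eq_relIndex_mul_measure_of_le (K H : Subgroup A) (hKH : K ≤ H) (hK : MeasurableSet (K : Set A))
    [(K.subgroupOf H).FiniteIndex] :
    μ (H : Set A) = K.relIndex H * μ (K : Set A) := by
  have hHK : (H : Set A) * (K : Set A) = (H : Set A) := by
    ext x
    constructor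
    · rintro ⟨h, hh, k, hk, rfl⟩
      exact H.mul_mem hh (hKH hk)
    · intro hx
      exact ⟨x, hx, 1, K.one_mem, mul_one x⟩
  rw [← hHK]
  exact measure_mul_eq_relIndex_mul_measure μ H K hK

/-- **P3 in measure form**: an index bound `K.relIndex H ≤ M` gives `μ H ≤ M * μ K`. -/
theorem measure_le_of_relIndex_le (K H : Subgroup A) (hKH : K ≤ H) (hK : MeasurableSet (K : Set A))
    [(K.subgroupOf H).FiniteIndex] {M : ℕ} (hM : K.relIndex H ≤ M) :
    μ (H : Set A) ≤ M * μ (K : Set A) := by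
  rw [measure_eq_relIndex_mul_measure_of_le μ K H hKH hK]
  gcongr

end Index

section Compact

variable {A : Type*} [Group A] [TopologicalSpace A] [IsTopologicalGroup A]

/-- **A compact subgroup meets an open subgroup in finite index**: `Z` compact, `B` open ⇒ `(B.subgroupOf Z).FiniteIndex`
(the hypothesis of `measure_mul_eq_relIndex_mul_measure` at `Z := Z ⊓ B₀` compact and `B` open). -/
theorem finiteIndex_subgroupOf_of_isCompact_of_isOpen (Z B : Subgroup A) (hZ : IsCompact (Z : Set A))
    (hB : IsOpen (B : Set A)) : (B.subgroupOf Z).FiniteIndex := by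
  haveI : CompactSpace Z := isCompact_iff_compactSpace.mp hZ
  have hopen : IsOpen ((B.subgroupOf Z : Subgroup Z) : Set Z) := by
    have : ((B.subgroupOf Z : Subgroup Z) : Set Z) = Subtype.val ⁻¹' (B : Set A) := by
      ext z
      simp [Subgroup.mem_subgroupOf]
    rw [this]
    exact hB.preimage continuous_subtype_val
  haveI : Finite (Z ⧸ B.subgroupOf Z) := Subgroup.quotient_finite_of_isOpen _ hopen
  exact Subgroup.finiteIndex_of_finite_quotient

/-- **A discrete subgroup meets a compact subgroup in a finite set**: `Γ` discrete, `H` compact (Hausdorff `A`) ⇒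
`Finite (H.subgroupOf Γ)` (the `[Finite]` hypothesis of `SaturationMeasure` at `Γ := Z(k)`, `H := Z⁰ · B_N` compact-open;
crit-1 S15675 R-SAT-COUNTABLE). -/
theorem finite_subgroupOf_of_discrete_of_isCompact [T2Space A] (Γ H : Subgroup A) [DiscreteTopology Γ]
    (hH : IsCompact (H : Set A)) : Finite (H.subgroupOf Γ) := by
  have hΓd : IsDiscrete (Γ : Set A) := isDiscrete_iff_discreteTopology.mpr ‹_›
  have hcl : IsClosed (Γ : Set A) := Subgroup.isClosed_of_discrete
  have hfin : ((Γ : Set A) ∩ (H : Set A)).Finite :=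
    (hH.inter_left hcl).finite (hΓd.mono inter_subset_left)
  haveI : Finite ((Γ : Set A) ∩ (H : Set A) : Set A) := hfin.to_subtype
  refine Finite.of_injective (fun x : H.subgroupOf Γ =>
    (⟨((x : Γ) : A), (x : Γ).2, Subgroup.mem_subgroupOf.1 x.2⟩ : ((Γ : Set A) ∩ (H : Set A) : Set A))) ?_
  intro x y hxy
  have h : ((x : Γ) : A) = ((y : Γ) : A) := congrArg Subtype.val (by simpa using hxy)
  exact Subtype.ext (Subtype.ext h)

end Compact

end Summit.Ventures.HodgeRepro.Tier4.Common

end
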